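import Literature.AnabelianGeometry.EtaleTheta.ThetaCoversTemperedOfSetting
import Literature.AnabelianGeometry.EtaleTheta.Discharge.Sec2PiCTemperedSide
import Literature.AnabelianGeometry.EtaleTheta.Discharge.Sec2CuspDecompositionReduction
import Literature.AnabelianGeometry.SemiGraphs.TemperedAnabelianWitness
import Mathlib.Topology.Algebra.Group.Pointwise
import HarnessLib

/-!
# [EtTh] §2 at the §1 model: the decomposition group of the cusp inside the assembled cover, and
# the Cor. 2.9 input `hC1` REDUCED to [SemiAnbd] Thm. 6.5 (ii) (proof-only companion)

Mochizuki, *The étale theta function and its Frobenioid-theoretic manifestations*, Publ. RIMS **45**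
(2009), §2: Def. 2.1 p. 35–36 ("`D_x ⊆ Π_X` the decomposition group of the cusp `x`", "every cusp of
`X̲` is `K`-rational"), Cor. 2.9 p. 43 (labels of cusps ↔ `Aut_K`-orbits) [cite: MochizukiEtTh2009, Cor 2.9 p.43];
Mochizuki, *Semi-graphs of anabelioids* [SemiAnbd], Publ. RIMS **42** (2006), Thm. 6.5 (ii) p. 71
("`D_x` is commensurably terminal").

Cell abc-iut, layer L2, seat abc-iut-L2-d3 (gen 5); W3-L2-02 residue. PROOF-ONLY (0 defs, no new `Prop`
fact; [SemiAnbd] Thm. 6.5 (ii) enters BY NAME as abc-iut-L3-t2's predicate `DecompCommensurablyTerminal`,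
FACT-LIST F-1658).

GAP-LEDGER G-L2d3-2 records that the Cor. 2.9 inputs `hC1 : T.cuspStabC ⊓ Π^tp_X ≤ Π^tp_X̲` and `hC2` of
`TemperedCoverData.cor29_card_undotted_of` are NOT consequences of abc-iut-L2-t2's interface (kernel
certificate: abc-iut-w5-d118's toy, `not_forall_hC1`). At the ARITHMETIC model — the cover
`MuTwoSetting.CLevelData.temperedCoverData` (ThetaCoversTemperedOfSetting, p429967) — `hC1` IS a
consequence of print's inputs (abc-iut-w5-d118's generic reduction `Sec2CuspDecompositionReduction` asks for
the tempered decomposition group `D^tp_{x_C}` of the cusp of `C` as data (B1)–(B3); here the `X`-side half is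
SUPPLIED at the model without that datum):

* `ThetaSetting.coe_decomp_eq_inertia_mul_range` / `isCompact_decomp_of_section` — with a continuous
  section `s` of `D_x ↠ G_K` (the `K`-rational cusp, cf. `Sec2SplittingOfSection`), `D_x = I_x · s(G_K)` is
  COMPACT (`I_x ≅ Ẑ(1)`, [SemiAnbd] p. 71, field `inertia_equiv_zHat`);
* `temperedCoverData_tp_Dx` — for compact `D_x`, the pulled-back decomposition group `T.tp T.Dx` of the
  assembled cover IS `inclX(D_x) ⊆ Π^tp_C` (`toHat(D_x)` is already closed, `ιC` injective);
* `temperedCoverData_cuspStabC` — hence `cuspStabC = N_{Π^tp_C}(inclX(D_x))`;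
* `temperedCoverData_tp_PiX` — `Π^tp` of `X` IS `inclX(Π^tp_X)` (`comap_range_hatInclX`);
* **`temperedCoverData_cuspStabC_inf_le_tp_Dx`** / **`temperedCoverData_hC1`** — `cuspStabC ∩ Π^tp_X = inclX`
  of `N_{Π^tp_X}(D_x) ⊆ Comm(D_x) = D_x` ([SemiAnbd] Thm. 6.5 (ii)), whence `hC1` by abc-iut-L2-d3 (gen 2)'s
  `cuspStabC_inf_le_of_selfNormalizing` (`D_x ⊆ Π_X̲`, Def. 2.1);
* `temperedCoverData_cor29_card_undotted` — Cor. 2.9 for `X̲̲, C̲, C̲̲` at the model modulo `hΘ` (G-L2d3-1),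
  `hC2`, `HasMuL` (abc-iut-L2-d3 (gen 2)'s `cor29_card_undotted_of` with `hC1` discharged).

So of G-L2d3-2 only `hC2` ("the inversion of `C` fixes the cusp": an element of `Π^tp_C ∖ Π^tp_X`
normalises `D_x`) remains an input at the model. HONEST FRAMING: nothing asserts that a `MuTwoSetting`, a
`CLevelData` or a section exists; [EtTh]/[SemiAnbd] are refereed; no side is taken on [IUTchIII]
Cor. 3.12; typed ≠ proved elsewhere.
-/

namespace Literature.AnabelianGeometry.EtaleTheta

open Literature.AnabelianGeometry.SemiGraphs ThetaCovers
open _root_.Topology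
open scoped Pointwise

/-! ### `D_x = I_x · s(G_K)` is compact for a continuous section -/

namespace ThetaSetting

variable {p : ℕ} [Fact p.Prime] (D : ThetaSetting p)

/-- **`D_x = I_x · s(G_K)`** for a section `s` of `D_x ↠ G_K` (`d = (d·s(aug d)⁻¹)·s(aug d)` with
`d·s(aug d)⁻¹ ∈ D_x ∩ Δ^tp_X = I_x`). [cite: MochizukiEtTh2009, Def 2.1 p.35] -/
theorem coe_decomp_eq_inertia_mul_range {x : D.Pt} (s : ↥D.GK →* D.PiTemp)
    (hs : ∀ σ, s σ ∈ D.decomp x) (hsa : ∀ σ, D.aug (s σ) = (σ : GQp p)) :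
    (D.decomp x : Set D.PiTemp) =
      ((D.decomp x ⊓ D.aug.toMonoidHom.ker : Subgroup D.PiTemp) : Set D.PiTemp) * Set.range s := by
  ext d
  constructor
  · intro hd
    have hσ : D.aug d ∈ D.GK := by
      change D.aug d ∈ D.K.fixingSubgroup
      rw [← D.range_aug]
      exact ⟨d, rfl⟩
    refine Set.mem_mul.mpr ⟨d * (s ⟨D.aug d, hσ⟩)⁻¹, ⟨?_, ?_⟩, s ⟨D.aug d, hσ⟩, ⟨_, rfl⟩, ?_⟩
    · exact Subgroup.mul_mem _ hd (Subgroup.inv_mem _ (hs _))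
    · change D.aug (d * (s ⟨D.aug d, hσ⟩)⁻¹) = 1
      rw [map_mul, map_inv, hsa, mul_inv_cancel]
    · group
  · rintro ⟨a, ⟨ha, -⟩, _, ⟨σ, rfl⟩, rfl⟩
    exact Subgroup.mul_mem _ ha (hs σ)

/-- **`D_x` is COMPACT** at a cusp `x` with a continuous section of `D_x ↠ G_K`: `I_x ≅ Ẑ(1)` is compact
([SemiAnbd] p. 71), `G_K = Gal(K̄/K)` is compact, and `D_x = I_x · s(G_K)`. [cite: MochizukiEtTh2009, Def 2.1 p.35] -/
theorem isCompact_decomp_of_section {x : D.Pt} (hx : D.IsCusp x) (s : ↥D.GK →* D.PiTemp)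
    (hs : ∀ σ, s σ ∈ D.decomp x) (hsa : ∀ σ, D.aug (s σ) = (σ : GQp p)) (hsc : Continuous s) :
    IsCompact (D.decomp x : Set D.PiTemp) := by
  haveI : CompactSpace (GQp p) := (isProfiniteCompletion_id_GQp (p := p)).compactSpace
  haveI : FiniteDimensional ℚ_[p] D.K := D.finiteDimensional_K
  have hGK : IsClosed ((D.GK : Subgroup (GQp p)) : Set (GQp p)) :=
    IntermediateField.fixingSubgroup_isClosed D.K
  haveI : CompactSpace ↥D.GK := isCompact_iff_compactSpace.mp hGK.isCompact
  obtain ⟨φ⟩ := D.inertia_equiv_zHat x hx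
  haveI : CompactSpace ↥(D.decomp x ⊓ D.aug.toMonoidHom.ker) := φ.symm.toHomeomorph.compactSpace
  have hI : IsCompact ((D.decomp x ⊓ D.aug.toMonoidHom.ker : Subgroup D.PiTemp) : Set D.PiTemp) :=
    isCompact_iff_compactSpace.mpr inferInstance
  rw [D.coe_decomp_eq_inertia_mul_range s hs hsa]
  exact hI.mul (isCompact_range hsc)

end ThetaSetting

/-! ### The cusp stabiliser of the assembled cover -/

namespace MuTwoSetting.CLevelData

variable {p : ℕ} [Fact p.Prime] {M : MuTwoSetting p}
variable {PC : Type} [Group PC] [TopologicalSpace PC] [IsTopologicalGroup PC] [T2Space PC]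

/-- **`Π^tp`-pull-back of `D_x` IS `inclX(D_x)`** for the assembled cover, when `D_x` is compact: `T.Dx` is
`Φ(cl(toHat(D_x)))` with `toHat(D_x)` compact hence closed, `Φ ∘ toHat = ιC ∘ inclX`, and `ιC` is injective.
[cite: MochizukiEtTh2009, Def 2.1 p.35] -/
theorem temperedCoverData_tp_Dx (e : M.CLevelData) (ιC : M.GtpC →ₜ* PC)
    (hιC : IsProfiniteCompletion ιC) (hinj : Function.Injective ιC) (op : M.toThetaSetting.OncePuncturedData)
    {l : ℕ} (hodd : Odd l) {x : M.Pt} (hx : M.IsCusp x)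
    (hIx : ((e.piCDataOf ιC hιC).Dx x ⊓ (e.piCDataOf ιC hιC).augGK.ker) ⊔ (e.piCDataOf ιC hιC).barKer l =
      (e.piCDataOf ιC hιC).barTheta l)
    (hιell : ∀ c ∈ (e.piCDataOf ιC hιC).augGK.ker, c ∉ (e.piCDataOf ιC hιC).PiX →
      ∀ d ∈ (e.piCDataOf ιC hιC).PiX ⊓ (e.piCDataOf ιC hιC).augGK.ker,
        c * d * c⁻¹ * d ∈ (e.piCDataOf ιC hιC).barTheta l)
    (hN : ((M.GtpXu l).map M.inclX).Normal) (hY : (M.GtpY.map M.inclX).Normal) {S : Subgroup PC}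
    (hS : ((e.piCDataOf ιC hιC).coverDataAx l op hx hodd hIx hιell
        ((e.piCDataOf ιC hιC).inv_theta_of_inv_ell l op hιell)).toCoverData.IsSplitting S)
    (hSc : IsClosed (S : Set PC)) (hDc : IsCompact (M.decomp x : Set M.PiTemp)) :
    (e.temperedCoverData ιC hιC hinj op hodd hx hIx hιell hN hY hS hSc).tp
        (e.temperedCoverData ιC hιC hinj op hodd hx hIx hιell hN hY hS hSc).Dx =
      (M.decomp x).map M.inclX := by
  -- `T.tp T.Dx = ιC⁻¹(Φ(cl(toHat(D_x))))`
  show (((((M.decomp x).map M.toHat.toMonoidHom).topologicalClosure).map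
      (e.piCDataOf ιC hιC).incl.toMonoidHom).comap ιC.toMonoidHom) = (M.decomp x).map M.inclX
  haveI : T2Space M.PiHat := M.isProfiniteCompletion_toHat.t2Space
  have hcl : ((M.decomp x).map M.toHat.toMonoidHom).topologicalClosure =
      (M.decomp x).map M.toHat.toMonoidHom := by
    refine le_antisymm (Subgroup.topologicalClosure_minimal _ le_rfl ?_) (Subgroup.le_topologicalClosure _)
    rw [Subgroup.coe_map]
    exact (hDc.image (map_continuous M.toHat)).isClosed
  have hcomp : (e.piCDataOf ιC hιC).incl.toMonoidHom.comp M.toHat.toMonoidHom = ιC.toMonoidHom.comp M.inclX :=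
    MonoidHom.ext fun y => e.piCDataOf_incl_toHat ιC hιC y
  rw [hcl, Subgroup.map_map, hcomp, ← Subgroup.map_map, Subgroup.comap_map_eq_self_of_injective hinj]

/-- **`Π^tp` of `X` IS `inclX(Π^tp_X)`** for the assembled cover (`comap_range_hatInclX` of
`Sec2PiCTemperedSide` at `Φ := incl`). [cite: MochizukiEtTh2009, Prop 2.4 p.38] -/
theorem temperedCoverData_tp_PiX (e : M.CLevelData) (ιC : M.GtpC →ₜ* PC)
    (hιC : IsProfiniteCompletion ιC) (hinj : Function.Injective ιC) (op : M.toThetaSetting.OncePuncturedData)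
    {l : ℕ} (hodd : Odd l) {x : M.Pt} (hx : M.IsCusp x)
    (hIx : ((e.piCDataOf ιC hιC).Dx x ⊓ (e.piCDataOf ιC hιC).augGK.ker) ⊔ (e.piCDataOf ιC hιC).barKer l =
      (e.piCDataOf ιC hιC).barTheta l)
    (hιell : ∀ c ∈ (e.piCDataOf ιC hιC).augGK.ker, c ∉ (e.piCDataOf ιC hιC).PiX →
      ∀ d ∈ (e.piCDataOf ιC hιC).PiX ⊓ (e.piCDataOf ιC hιC).augGK.ker,
        c * d * c⁻¹ * d ∈ (e.piCDataOf ιC hιC).barTheta l)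
    (hN : ((M.GtpXu l).map M.inclX).Normal) (hY : (M.GtpY.map M.inclX).Normal) {S : Subgroup PC}
    (hS : ((e.piCDataOf ιC hιC).coverDataAx l op hx hodd hIx hιell
        ((e.piCDataOf ιC hιC).inv_theta_of_inv_ell l op hιell)).toCoverData.IsSplitting S)
    (hSc : IsClosed (S : Set PC)) :
    (e.temperedCoverData ιC hιC hinj op hodd hx hIx hιell hN hY hS hSc).tp
        (e.temperedCoverData ιC hιC hinj op hodd hx hIx hιell hN hY hS hSc).PiX = M.inclX.range :=
  comap_range_hatInclX ιC hιC (e.piCDataOf ιC hιC).incl (e.piCDataOf_incl_toHat ιC hιC)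

/-- **`cuspStabC = N_{Π^tp_C}(inclX(D_x))`** for the assembled cover (compact `D_x`).
[cite: MochizukiEtTh2009, Cor 2.9 p.43] -/
theorem temperedCoverData_cuspStabC (e : M.CLevelData) (ιC : M.GtpC →ₜ* PC)
    (hιC : IsProfiniteCompletion ιC) (hinj : Function.Injective ιC) (op : M.toThetaSetting.OncePuncturedData)
    {l : ℕ} (hodd : Odd l) {x : M.Pt} (hx : M.IsCusp x)
    (hIx : ((e.piCDataOf ιC hιC).Dx x ⊓ (e.piCDataOf ιC hιC).augGK.ker) ⊔ (e.piCDataOf ιC hιC).barKer l =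
      (e.piCDataOf ιC hιC).barTheta l)
    (hιell : ∀ c ∈ (e.piCDataOf ιC hιC).augGK.ker, c ∉ (e.piCDataOf ιC hιC).PiX →
      ∀ d ∈ (e.piCDataOf ιC hιC).PiX ⊓ (e.piCDataOf ιC hιC).augGK.ker,
        c * d * c⁻¹ * d ∈ (e.piCDataOf ιC hιC).barTheta l)
    (hN : ((M.GtpXu l).map M.inclX).Normal) (hY : (M.GtpY.map M.inclX).Normal) {S : Subgroup PC}
    (hS : ((e.piCDataOf ιC hιC).coverDataAx l op hx hodd hIx hιell
        ((e.piCDataOf ιC hιC).inv_theta_of_inv_ell l op hιell)).toCoverData.IsSplitting S)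
    (hSc : IsClosed (S : Set PC)) (hDc : IsCompact (M.decomp x : Set M.PiTemp)) :
    (e.temperedCoverData ιC hιC hinj op hodd hx hIx hιell hN hY hS hSc).cuspStabC =
      Subgroup.normalizer (((M.decomp x).map M.inclX : Subgroup M.GtpC) : Set M.GtpC) := by
  rw [TemperedCoverData.cuspStabC, temperedCoverData_tp_Dx e ιC hιC hinj op hodd hx hIx hιell hN hY hS hSc hDc]
  rfl

/-- **The stabiliser in `Π^tp_X` of the cusp IS `inclX(D_x)`-bounded at the model** modulo [SemiAnbd]
Thm. 6.5 (ii): `cuspStabC ∩ Π^tp_X ≤ tp D_x` — an element `inclX(h)` of `Π^tp_X` normalising `inclX(D_x)`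
has `h ∈ N_{Π^tp_X}(D_x) ⊆ Comm(D_x) = D_x` (`DecompCommensurablyTerminal` = F-1658 BY NAME; compact `D_x`).
[cite: MochizukiSemiAnbd2006, Thm 6.5(ii) p.71] -/
theorem temperedCoverData_cuspStabC_inf_le_tp_Dx (e : M.CLevelData) (ιC : M.GtpC →ₜ* PC)
    (hιC : IsProfiniteCompletion ιC) (hinj : Function.Injective ιC) (op : M.toThetaSetting.OncePuncturedData)
    {l : ℕ} (hodd : Odd l) {x : M.Pt} (hx : M.IsCusp x)
    (hIx : ((e.piCDataOf ιC hιC).Dx x ⊓ (e.piCDataOf ιC hιC).augGK.ker) ⊔ (e.piCDataOf ιC hιC).barKer l =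
      (e.piCDataOf ιC hιC).barTheta l)
    (hιell : ∀ c ∈ (e.piCDataOf ιC hιC).augGK.ker, c ∉ (e.piCDataOf ιC hιC).PiX →
      ∀ d ∈ (e.piCDataOf ιC hιC).PiX ⊓ (e.piCDataOf ιC hιC).augGK.ker,
        c * d * c⁻¹ * d ∈ (e.piCDataOf ιC hιC).barTheta l)
    (hN : ((M.GtpXu l).map M.inclX).Normal) (hY : (M.GtpY.map M.inclX).Normal) {S : Subgroup PC}
    (hS : ((e.piCDataOf ιC hιC).coverDataAx l op hx hodd hIx hιell
        ((e.piCDataOf ιC hιC).inv_theta_of_inv_ell l op hιell)).toCoverData.IsSplitting S)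
    (hSc : IsClosed (S : Set PC)) (hDc : IsCompact (M.decomp x : Set M.PiTemp))
    (h65 : M.toTemperedCurve.DecompCommensurablyTerminal) :
    (e.temperedCoverData ιC hιC hinj op hodd hx hIx hιell hN hY hS hSc).cuspStabC ⊓ (e.temperedCoverData ιC hιC hinj op hodd hx hIx hιell hN hY hS hSc).tp (e.temperedCoverData ιC hιC hinj op hodd hx hIx hιell hN hY hS hSc).PiX ≤ (e.temperedCoverData ιC hιC hinj op hodd hx hIx hιell hN hY hS hSc).tp (e.temperedCoverData ιC hιC hinj op hodd hx hIx hιell hN hY hS hSc).Dx := by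
  rw [temperedCoverData_cuspStabC e ιC hιC hinj op hodd hx hIx hιell hN hY hS hSc hDc, temperedCoverData_tp_PiX e ιC hιC hinj op hodd hx hIx hιell hN hY hS hSc,
    temperedCoverData_tp_Dx e ιC hιC hinj op hodd hx hIx hιell hN hY hS hSc hDc]
  rintro g ⟨hgN, hgX⟩
  obtain ⟨h, rfl⟩ : ∃ h, M.inclX h = g := hgX
  have hgN' : M.inclX h ∈ Subgroup.normalizer (((M.decomp x).map M.inclX : Subgroup M.GtpC) : Set M.GtpC) :=
    hgN
  -- `h ∈ N_{Π^tp_X}(D_x)` (transport along the injective `inclX`)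
  have hhN : h ∈ Subgroup.normalizer ((M.decomp x : Subgroup M.PiTemp) : Set M.PiTemp) := by
    rw [Subgroup.mem_normalizer_iff] at hgN' ⊢
    intro d
    rw [← Subgroup.mem_map_iff_mem M.injective_inclX, ← Subgroup.mem_map_iff_mem M.injective_inclX
      (x := h * d * h⁻¹), map_mul, map_mul, map_inv]
    exact hgN' (M.inclX d)
  -- `N(D_x) ≤ Comm(D_x) = D_x` ([SemiAnbd] Thm 6.5 (ii))
  have hhD : h ∈ M.decomp x := by
    rw [← h65 x]
    exact ThetaCovers.normalizer_le_commensurator _ hhN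
  exact ⟨h, hhD, rfl⟩

/-- **`hC1` HOLDS at the arithmetic model modulo [SemiAnbd] Thm. 6.5 (ii)**: `cuspStabC ∩ Π^tp_X ≤ Π^tp_X̲`
for the assembled cover (compact `D_x`, e.g. from a continuous section of `D_x ↠ G_K`;
`DecompCommensurablyTerminal` = F-1658 BY NAME), by abc-iut-L2-d3 (gen 2)'s
`cuspStabC_inf_le_of_selfNormalizing` (`D_x ⊆ Π_X̲`, "the restricted map `D_x → Q` is trivial", Def. 2.1).
Input `hC1` of `TemperedCoverData.cor29_card_undotted_of` (GAP-LEDGER G-L2d3-2) discharged at the model.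
[cite: MochizukiEtTh2009, Cor 2.9 p.43] -/
theorem temperedCoverData_hC1 (e : M.CLevelData) (ιC : M.GtpC →ₜ* PC)
    (hιC : IsProfiniteCompletion ιC) (hinj : Function.Injective ιC) (op : M.toThetaSetting.OncePuncturedData)
    {l : ℕ} (hodd : Odd l) {x : M.Pt} (hx : M.IsCusp x)
    (hIx : ((e.piCDataOf ιC hιC).Dx x ⊓ (e.piCDataOf ιC hιC).augGK.ker) ⊔ (e.piCDataOf ιC hιC).barKer l =
      (e.piCDataOf ιC hιC).barTheta l)
    (hιell : ∀ c ∈ (e.piCDataOf ιC hιC).augGK.ker, c ∉ (e.piCDataOf ιC hιC).PiX →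
      ∀ d ∈ (e.piCDataOf ιC hιC).PiX ⊓ (e.piCDataOf ιC hιC).augGK.ker,
        c * d * c⁻¹ * d ∈ (e.piCDataOf ιC hιC).barTheta l)
    (hN : ((M.GtpXu l).map M.inclX).Normal) (hY : (M.GtpY.map M.inclX).Normal) {S : Subgroup PC}
    (hS : ((e.piCDataOf ιC hιC).coverDataAx l op hx hodd hIx hιell
        ((e.piCDataOf ιC hιC).inv_theta_of_inv_ell l op hιell)).toCoverData.IsSplitting S)
    (hSc : IsClosed (S : Set PC)) (hDc : IsCompact (M.decomp x : Set M.PiTemp))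
    (h65 : M.toTemperedCurve.DecompCommensurablyTerminal) :
    (e.temperedCoverData ιC hιC hinj op hodd hx hIx hιell hN hY hS hSc).cuspStabC ⊓ (e.temperedCoverData ιC hιC hinj op hodd hx hIx hιell hN hY hS hSc).tp (e.temperedCoverData ιC hιC hinj op hodd hx hIx hιell hN hY hS hSc).PiX ≤ (e.temperedCoverData ιC hιC hinj op hodd hx hIx hιell hN hY hS hSc).tp (e.temperedCoverData ιC hιC hinj op hodd hx hIx hιell hN hY hS hSc).PiXu :=
  (e.temperedCoverData ιC hιC hinj op hodd hx hIx hιell hN hY hS hSc).cuspStabC_inf_le_of_selfNormalizing (temperedCoverData_cuspStabC_inf_le_tp_Dx e ιC hιC hinj op hodd hx hIx hιell hN hY hS hSc hDc h65)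

/-- **`hC1` at the model from a continuous section** (compactness of `D_x` supplied by
`isCompact_decomp_of_section`). [cite: MochizukiEtTh2009, Cor 2.9 p.43] -/
theorem temperedCoverData_hC1_of_section (e : M.CLevelData) (ιC : M.GtpC →ₜ* PC)
    (hιC : IsProfiniteCompletion ιC) (hinj : Function.Injective ιC) (op : M.toThetaSetting.OncePuncturedData)
    {l : ℕ} (hodd : Odd l) {x : M.Pt} (hx : M.IsCusp x)
    (hIx : ((e.piCDataOf ιC hιC).Dx x ⊓ (e.piCDataOf ιC hιC).augGK.ker) ⊔ (e.piCDataOf ιC hιC).barKer l =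
      (e.piCDataOf ιC hιC).barTheta l)
    (hιell : ∀ c ∈ (e.piCDataOf ιC hιC).augGK.ker, c ∉ (e.piCDataOf ιC hιC).PiX →
      ∀ d ∈ (e.piCDataOf ιC hιC).PiX ⊓ (e.piCDataOf ιC hιC).augGK.ker,
        c * d * c⁻¹ * d ∈ (e.piCDataOf ιC hιC).barTheta l)
    (hN : ((M.GtpXu l).map M.inclX).Normal) (hY : (M.GtpY.map M.inclX).Normal) {S : Subgroup PC}
    (hS : ((e.piCDataOf ιC hιC).coverDataAx l op hx hodd hIx hιell
        ((e.piCDataOf ιC hιC).inv_theta_of_inv_ell l op hιell)).toCoverData.IsSplitting S)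
    (hSc : IsClosed (S : Set PC))
    (s : ↥M.GK →* M.PiTemp) (hs : ∀ σ, s σ ∈ M.decomp x) (hsa : ∀ σ, M.aug (s σ) = (σ : GQp p))
    (hsc : Continuous s) (h65 : M.toTemperedCurve.DecompCommensurablyTerminal) :
    (e.temperedCoverData ιC hιC hinj op hodd hx hIx hιell hN hY hS hSc).cuspStabC ⊓
        (e.temperedCoverData ιC hιC hinj op hodd hx hIx hιell hN hY hS hSc).tp
          (e.temperedCoverData ιC hιC hinj op hodd hx hIx hιell hN hY hS hSc).PiX ≤
      (e.temperedCoverData ιC hιC hinj op hodd hx hIx hιell hN hY hS hSc).tp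
        (e.temperedCoverData ιC hιC hinj op hodd hx hIx hιell hN hY hS hSc).PiXu :=
  temperedCoverData_hC1 e ιC hιC hinj op hodd hx hIx hιell hN hY hS hSc
    (M.toThetaSetting.isCompact_decomp_of_section hx s hs hsa hsc) h65

/-- **Cor. 2.9 for `X̲̲, C̲, C̲̲` at the arithmetic model** (`μ_l ⊆ K`; `#(Aut_K(−)-orbits of cusps) =
(l+1)/2`), by abc-iut-L2-d3 (gen 2)'s `cor29_card_undotted_of` with `hC1` DISCHARGED (compact `D_x`,
[SemiAnbd] Thm. 6.5 (ii) BY NAME); residual inputs: `hΘ` (the printed definition of `Δ̄_Θ`, GAP-LEDGER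
G-L2d3-1) and `hC2` (the inversion of `C` fixes the cusp, G-L2d3-2). [cite: MochizukiEtTh2009, Cor 2.9 p.43] -/
theorem temperedCoverData_cor29_card_undotted (e : M.CLevelData) (ιC : M.GtpC →ₜ* PC)
    (hιC : IsProfiniteCompletion ιC) (hinj : Function.Injective ιC) (op : M.toThetaSetting.OncePuncturedData)
    {l : ℕ} (hodd : Odd l) {x : M.Pt} (hx : M.IsCusp x)
    (hIx : ((e.piCDataOf ιC hιC).Dx x ⊓ (e.piCDataOf ιC hιC).augGK.ker) ⊔ (e.piCDataOf ιC hιC).barKer l =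
      (e.piCDataOf ιC hιC).barTheta l)
    (hιell : ∀ c ∈ (e.piCDataOf ιC hιC).augGK.ker, c ∉ (e.piCDataOf ιC hιC).PiX →
      ∀ d ∈ (e.piCDataOf ιC hιC).PiX ⊓ (e.piCDataOf ιC hιC).augGK.ker,
        c * d * c⁻¹ * d ∈ (e.piCDataOf ιC hιC).barTheta l)
    (hN : ((M.GtpXu l).map M.inclX).Normal) (hY : (M.GtpY.map M.inclX).Normal) {S : Subgroup PC}
    (hS : ((e.piCDataOf ιC hιC).coverDataAx l op hx hodd hIx hιell
        ((e.piCDataOf ιC hιC).inv_theta_of_inv_ell l op hιell)).toCoverData.IsSplitting S)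
    (hSc : IsClosed (S : Set PC)) (hDc : IsCompact (M.decomp x : Set M.PiTemp))
    (h65 : M.toTemperedCurve.DecompCommensurablyTerminal)
    (hΘ : ⁅(e.temperedCoverData ιC hιC hinj op hodd hx hIx hιell hN hY hS hSc).DeltaX, (e.temperedCoverData ιC hιC hinj op hodd hx hIx hιell hN hY hS hSc).DeltaX⁆ ⊔ (e.temperedCoverData ιC hιC hinj op hodd hx hIx hιell hN hY hS hSc).barKer = (e.temperedCoverData ιC hιC hinj op hodd hx hIx hιell hN hY hS hSc).barTheta)
    (hC2 : ¬ (e.temperedCoverData ιC hιC hinj op hodd hx hIx hιell hN hY hS hSc).cuspStabC ≤ (e.temperedCoverData ιC hιC hinj op hodd hx hIx hιell hN hY hS hSc).tp (e.temperedCoverData ιC hιC hinj op hodd hx hIx hιell hN hY hS hSc).PiX) :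
    (e.temperedCoverData ιC hιC hinj op hodd hx hIx hιell hN hY hS hSc).HasMuL → ∀ S' ∈ [(e.temperedCoverData ιC hιC hinj op hodd hx hIx hιell hN hY hS hSc).tp (e.temperedCoverData ιC hιC hinj op hodd hx hIx hιell hN hY hS hSc).PiXuu, (e.temperedCoverData ιC hιC hinj op hodd hx hIx hιell hN hY hS hSc).tp (e.temperedCoverData ιC hιC hinj op hodd hx hIx hιell hN hY hS hSc).PiCu, (e.temperedCoverData ιC hιC hinj op hodd hx hIx hιell hN hY hS hSc).tp (e.temperedCoverData ιC hιC hinj op hodd hx hIx hιell hN hY hS hSc).PiCuu],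
      Nat.card ((e.temperedCoverData ιC hιC hinj op hodd hx hIx hιell hN hY hS hSc).cuspOrbits S') = (l + 1) / 2 :=
  (e.temperedCoverData ιC hιC hinj op hodd hx hIx hιell hN hY hS hSc).cor29_card_undotted_of hΘ (temperedCoverData_hC1 e ιC hιC hinj op hodd hx hIx hιell hN hY hS hSc hDc h65) hC2

end MuTwoSetting.CLevelData

end Literature.AnabelianGeometry.EtaleTheta
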